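import Summits.QuantumAdvantage.QuantumAdvantage.Theorems.SosSandwichPseudoBoundedTopPairing
import Summits.QuantumAdvantage.QuantumAdvantage.Theorems.SosSandwichPseudoBoundedClosure
import Summits.QuantumAdvantage.QuantumAdvantage.Theorems.SosSandwichHomogeneousPBAARefutation
import Summits.QuantumAdvantage.QuantumAdvantage.Theorems.SosSandwichPseudoBoundedAARepairedLine
import HarnessLib

/-!
# Route item `HomogeneousPBAAT` (stmt-27399) ⟸ a uniform contraction bound on the SOS class `K_T`

Companion of `Theorems/SosSandwichPseudoBoundedTopPairing.lean` (crux `PseudoBoundedAA`, stmt-QuantumAdvantage-15237).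
There, `TopPairing.homogeneousRung_of_contraction`: for a top-homogeneous `p = Σ_j q_j² ∈ K_T` whose SOS data obey the
contraction estimate with constant `K`, `∃ k, 4 Var[p]² ≤ K·Inf_k[p]`.  Here the packaged consequence for the route:

* **`homogeneousPBAAT_of_contractionBound`** — if EVERY SOS datum of order `T` (degrees `≤ T`, square-sum `≤ 1` on
  the cube) satisfies the contraction estimate with `K = A·T^a` (`a : ℕ`, `A > 0` absolute), then the route item
  `Theses.SosSandwich.HomogeneousPBAAT` holds with `(c, C) = (a + 2, 4/A)`.
* **`pseudoBoundedAA_of_contractionBound_of_levelDescent`** — the RE-REGISTRABLE LINE: ContractionBound → (registered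
  `stub_levelDescent`, tree vocabulary) → `PseudoBoundedAA` (composition with `pseudoBoundedAA_of_homogeneousPBAAT_of_levelDescent`).
* **`contraction_ge_of_addr`** — calibration IN KERNEL: for the address counterexample `P` of order `T = 2^{k+1}`
  (`AddrWitness.exists_counterexample`: `Var = 1/4`, every influence `1/T`), EVERY SOS datum of `P` and every
  admissible contraction constant `K` satisfy `T/4 ≤ K`; hence **`not_uniform_contractionBound`** — no `T`-free
  contraction constant serves all of `K_T` (the exponent `a` above is `≥ 1`; `a = 1` is the conjectured sharp order).

So the repaired homogeneous rung of the registered line of 15237 (`stub_homogeneousRung`, refuted in its degree-free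
form) is reduced to ONE inline analytic statement about degree-`T` SOS data — TRUE with `K = 1` on `Q_T`
(`QueryTopLevel.sum_norm_sq_gam_finalState_le`), forced to be `≥ T/2` on the address family of `not_HomogeneousPBAA`
(so `a ≥ 1`; `a = 1` would give the conjectured sharp order `Var²/T`), OPEN on `K_T` in general.  Honest label:
composition/reduction (conditional result); it proves neither 27399 nor the crux.

Sources: EscuderoGutierrez2023 (arXiv:2304.06713) Cor 1.7, Question 4.5; AaronsonAmbainis2014 Conj. 6.
-/

set_option linter.dupNamespace false

noncomputable section

namespace Summit.QuantumAdvantage.QuantumAdvantage.Theorems.SosSandwich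

open Finset MvPolynomial Literature.Computability.QuantumComplexity
open Literature.Computability.Complexity.LowDegree Literature.Probability.RandomGraphs.LowDegree
open scoped symmDiff

namespace TopPairing

variable {N : ℕ}

/-! ### §5 `HomogeneousPBAAT` from a uniform contraction bound on the SOS class -/

/-- A polynomial in `0` variables is constant on the cube, so positive variance forces `N ≥ 1`. [folklore] -/
theorem dim_pos_of_boolVariance_pos (p : MvPolynomial (Fin N) ℝ) (hvar : 0 < boolVariance p) : 0 < N := by
  by_contra hN0
  have hN0' : N = 0 := by omega
  subst hN0'
  have hconst : ∀ x : Fin 0 → Bool, x = fun i => i.elim0 := fun x => funext fun i => i.elim0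
  have hV0 : boolVariance p = 0 := by
    unfold boolVariance boolAvg
    simp [Finset.univ_unique, hconst]
  rw [hV0] at hvar
  exact lt_irrefl _ hvar

/-- **The route item `HomogeneousPBAAT` (stmt-27399) follows from a uniform contraction bound on `K_T`.**
Hypothesis (inline, no new definition): there are `a : ℕ` and `A > 0` such that for every `N, T ≥ 1`, every SOS
datum `(q_j)_{j<m}` of total degrees `≤ T` whose square-sum `p = Σ_j q_j²` is at most `1` on the cube, the
top-level coefficients satisfy the contraction estimate of `topWeight_sq_le_of_contraction` with `K = A·T^a`.
Conclusion: `HomogeneousPBAAT` with `(c, C) = (a + 2, 4/A)` (`4Var² ≤ A Tᵃ Inf` and `Var ≤ 1/4 ≤ T` give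
`(4/A)(Var/T)^{a+2} ≤ Inf`).  Status of the hypothesis: TRUE with `K = 1` on `Q_T` (tree), `K ≥ T/2` forced on the
address family, OPEN on `K_T` in general — a candidate replacement for the refuted stub `stub_homogeneousRung`.
[cite: EscuderoGutierrez2023, Cor 1.7, Question 4.5] -/
theorem homogeneousPBAAT_of_contractionBound
    (h : ∃ (a : ℕ) (A : ℝ), 0 < A ∧ ∀ (N T m : ℕ) (q : Fin m → MvPolynomial (Fin N) ℝ)
      (p : MvPolynomial (Fin N) ℝ), 1 ≤ T → (∀ j, (q j).totalDegree ≤ T) →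
      (∀ x, evalBool p x = ∑ j, evalBool (q j) x ^ 2) → (∀ x, evalBool p x ≤ 1) →
      ∀ (c : Finset (Fin N) → ℝ) (M : ℝ),
        (∀ k : Fin N, ∑ U ∈ Finset.univ.filter (fun U : Finset (Fin N) => U.card = 2 * T ∧ k ∈ U), c U ^ 2 ≤ M) →
        ∑ j, ∑ R ∈ Finset.univ.filter (fun R : Finset (Fin N) => R.card = T),
          (∑ U ∈ Finset.univ.filter (fun U : Finset (Fin N) => U.card = 2 * T ∧ R ⊆ U),
            c U * cubeFourierCoeff (evalBool (q j)) (U \ R)) ^ 2 ≤ A * (T : ℝ) ^ a * M) :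
    Summit.QuantumAdvantage.QuantumAdvantage.Theses.SosSandwich.HomogeneousPBAAT := by
  obtain ⟨a, A, hA, H⟩ := h
  refine ⟨a + 2, 4 / A, by positivity, ?_⟩
  intro N T p ev avg hT hpb hhom hvar
  -- the inline vocabulary is definitionally the tree's
  change ∃ i : Fin N, 4 / A * (boolVariance p / (T : ℝ)) ^ (a + 2) ≤ influence i p
  change 0 < boolVariance p at hvar
  have hpK : PseudoBounded T p := hpb
  obtain ⟨m, q, r, hqr, hval⟩ := hpb
  have hq : ∀ j, (q j).totalDegree ≤ T := fun j => (hqr j).1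
  have hp : ∀ x, evalBool p x = ∑ j, evalBool (q j) x ^ 2 := fun x => (hval x).1
  have hp1 : ∀ x, evalBool p x ≤ 1 := fun x => hpK.eval_le_one x
  have hN : 0 < N := dim_pos_of_boolVariance_pos p hvar
  obtain ⟨k, hk⟩ := homogeneousRung_of_contraction hT hN q hq p hp hp1 (A * (T : ℝ) ^ a)
    (H N T m q p hT hq hp hp1) hhom
  refine ⟨k, le_trans (b := 4 * boolVariance p ^ 2 / (A * (T : ℝ) ^ a)) ?_ ?_⟩
  · -- `(4/A) (Var/T)^{a+2} ≤ 4 Var² / (A T^a)` since `Var^a ≤ 1 ≤ T²`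
    have hT1 : (1 : ℝ) ≤ T := by exact_mod_cast hT
    have hTpos : (0 : ℝ) < T := by linarith
    have hV4 : boolVariance p ≤ 1 / 4 := boolVariance_le_quarter hpK
    have hV0 : 0 ≤ boolVariance p := boolVariance_nonneg p
    have hVa : boolVariance p ^ a ≤ 1 := pow_le_one₀ hV0 (by linarith)
    have hT2 : (1 : ℝ) ≤ (T : ℝ) ^ 2 := one_le_pow₀ hT1
    have hVT : boolVariance p ^ a ≤ (T : ℝ) ^ 2 := hVa.trans hT2
    have key : (boolVariance p / (T : ℝ)) ^ (a + 2) ≤ boolVariance p ^ 2 / (T : ℝ) ^ a := by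
      rw [div_pow, div_le_div_iff₀ (by positivity) (by positivity)]
      calc boolVariance p ^ (a + 2) * (T : ℝ) ^ a
          = boolVariance p ^ a * (boolVariance p ^ 2 * (T : ℝ) ^ a) := by ring
        _ ≤ (T : ℝ) ^ 2 * (boolVariance p ^ 2 * (T : ℝ) ^ a) :=
            mul_le_mul_of_nonneg_right hVT (by positivity)
        _ = boolVariance p ^ 2 * (T : ℝ) ^ (a + 2) := by ring
    calc 4 / A * (boolVariance p / (T : ℝ)) ^ (a + 2)
        ≤ 4 / A * (boolVariance p ^ 2 / (T : ℝ) ^ a) := mul_le_mul_of_nonneg_left key (by positivity)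
      _ = 4 * boolVariance p ^ 2 / (A * (T : ℝ) ^ a) := by rw [div_mul_div_comm]
  · rw [div_le_iff₀ (by positivity)]
    linarith


/-! ### §6 Calibration in kernel: the address family forces `K ≥ T/4`, so no `T`-free constant exists -/

/-- **The address counterexample forces a contraction constant `≥ T/4`.**  For every `k` there is a top-homogeneous
`P ∈ K_T`, `T = 2^{k+1}` (the iterated-address polynomial of `AddrWitness.exists_counterexample`: `Var[P] = 1/4`, every
influence `1/T`), such that for EVERY SOS datum `(q_j)` of `P` (degrees `≤ T`, `P = Σ_j q_j²` on the cube) every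
constant `K` for which the contraction estimate of `topWeight_sq_le_of_contraction` holds satisfies `T/4 ≤ K`
(`4·(1/4)² ≤ K·(1/T)`).  [cite: EscuderoGutierrez2023, Cor 1.7] -/
theorem contraction_ge_of_addr (k : ℕ) : ∃ (N : ℕ) (P : MvPolynomial (Fin N) ℝ),
    PseudoBounded (2 ^ (k + 1)) P ∧
    (∀ z, ∑ i, (evalBool P z - evalBool P (flipBit i z)) =
      4 * ((2 ^ (k + 1) : ℕ) : ℝ) * (evalBool P z - boolAvg (evalBool P))) ∧
    ∀ (m : ℕ) (q : Fin m → MvPolynomial (Fin N) ℝ), (∀ j, (q j).totalDegree ≤ 2 ^ (k + 1)) →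
      (∀ x, evalBool P x = ∑ j, evalBool (q j) x ^ 2) →
      ∀ K : ℝ, (∀ (c : Finset (Fin N) → ℝ) (M : ℝ),
        (∀ i : Fin N, ∑ U ∈ Finset.univ.filter (fun U : Finset (Fin N) => U.card = 2 * 2 ^ (k + 1) ∧ i ∈ U),
          c U ^ 2 ≤ M) →
        ∑ j, ∑ R ∈ Finset.univ.filter (fun R : Finset (Fin N) => R.card = 2 ^ (k + 1)),
          (∑ U ∈ Finset.univ.filter (fun U : Finset (Fin N) => U.card = 2 * 2 ^ (k + 1) ∧ R ⊆ U),
            c U * cubeFourierCoeff (evalBool (q j)) (U \ R)) ^ 2 ≤ K * M) →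
      (2 : ℝ) ^ (k + 1) / 4 ≤ K := by
  obtain ⟨N, P, hPB, hLap, hVar, hInf⟩ := AddrWitness.exists_counterexample k
  refine ⟨N, P, hPB, hLap, fun m q hq hP K hK => ?_⟩
  have hT : 1 ≤ 2 ^ (k + 1) := Nat.one_le_two_pow
  have hvar0 : 0 < boolVariance P := by rw [hVar]; norm_num
  have hN : 0 < N := dim_pos_of_boolVariance_pos P hvar0
  have hP1 : ∀ x, evalBool P x ≤ 1 := fun x => hPB.eval_le_one x
  have hLap' : ∀ x : Fin N → Bool, ∑ i : Fin N, (evalBool P x - evalBool P (Function.update x i (!x i))) =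
      4 * ((2 ^ (k + 1) : ℕ) : ℝ) * (evalBool P x - boolAvg (evalBool P)) := hLap
  obtain ⟨i, hi⟩ := homogeneousRung_of_contraction hT hN q hq P hP hP1 K hK hLap'
  rw [hVar, hInf] at hi
  have h2pos : (0 : ℝ) < 2 ^ (k + 1) := by positivity
  have h3 : 4 * (1 / 4 : ℝ) ^ 2 = 1 / 4 := by norm_num
  have h4 : K * (1 / (2 : ℝ) ^ (k + 1)) = K / 2 ^ (k + 1) := by ring
  rw [h3, h4, le_div_iff₀ h2pos] at hi
  rw [div_le_iff₀ (by norm_num : (0 : ℝ) < 4)]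
  linarith

/-- **No `T`-free contraction constant on `K_T`.**  There is no absolute `K` such that every SOS datum of every order
`T ≥ 1` (degrees `≤ T`, square-sum `≤ 1` on the cube) satisfies the contraction estimate with constant `K`
(`contraction_ge_of_addr` with `2^{k+1} > 4K`).  Equivalently: the exponent `a` in `homogeneousPBAAT_of_contractionBound`
must be `≥ 1` — the degree-free Escudero-Gutiérrez mechanism (K = 1 on `Q_T`) cannot run on `K_T` unchanged, in kernel.
[cite: EscuderoGutierrez2023, Cor 1.7] -/
theorem not_uniform_contractionBound :
    ¬ ∃ K : ℝ, ∀ (N T m : ℕ) (q : Fin m → MvPolynomial (Fin N) ℝ) (p : MvPolynomial (Fin N) ℝ),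
      1 ≤ T → (∀ j, (q j).totalDegree ≤ T) →
      (∀ x, evalBool p x = ∑ j, evalBool (q j) x ^ 2) → (∀ x, evalBool p x ≤ 1) →
      ∀ (c : Finset (Fin N) → ℝ) (M : ℝ),
        (∀ k : Fin N, ∑ U ∈ Finset.univ.filter (fun U : Finset (Fin N) => U.card = 2 * T ∧ k ∈ U), c U ^ 2 ≤ M) →
        ∑ j, ∑ R ∈ Finset.univ.filter (fun R : Finset (Fin N) => R.card = T),
          (∑ U ∈ Finset.univ.filter (fun U : Finset (Fin N) => U.card = 2 * T ∧ R ⊆ U),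
            c U * cubeFourierCoeff (evalBool (q j)) (U \ R)) ^ 2 ≤ K * M := by
  rintro ⟨K, hK⟩
  obtain ⟨k, hk⟩ := pow_unbounded_of_one_lt (4 * K) (by norm_num : (1 : ℝ) < 2)
  obtain ⟨N, P, hPB, -, hforall⟩ := contraction_ge_of_addr k
  obtain ⟨m, q, r, hqr, hval⟩ := hPB
  have hq : ∀ j, (q j).totalDegree ≤ 2 ^ (k + 1) := fun j => (hqr j).1
  have hP : ∀ x, evalBool P x = ∑ j, evalBool (q j) x ^ 2 := fun x => (hval x).1
  have hPB' : PseudoBounded (2 ^ (k + 1)) P := ⟨m, q, r, hqr, hval⟩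
  have hP1 : ∀ x, evalBool P x ≤ 1 := fun x => hPB'.eval_le_one x
  have hle := hforall m q hq hP K (hK N (2 ^ (k + 1)) m q P Nat.one_le_two_pow hq hP hP1)
  have hmono : (2 : ℝ) ^ k ≤ 2 ^ (k + 1) := pow_le_pow_right₀ (by norm_num) (Nat.le_succ k)
  linarith


/-! ### §7 The re-registrable line: ContractionBound → LevelDescent → PseudoBoundedAA -/

/-- **The repaired birth line of the crux with the contraction bound as its rung.**  A uniform contraction bound on
degree-`T` SOS data (hypothesis of `homogeneousPBAAT_of_contractionBound`) and level descent inside `K_T` (the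
registered `stub_levelDescent` of `Cruxes/PseudoBoundedAA/Lines/birth.lean`, in the tree's vocabulary) give the crux
`PseudoBoundedAA` — composition with `pseudoBoundedAA_of_homogeneousPBAAT_of_levelDescent` (lineage leafhand-2 g8).
So `PseudoBoundedAA_of := fun hK hD => pseudoBoundedAA_of_contractionBound_of_levelDescent hK hD` re-registers the
line with `stub_homogeneousRung` replaced by the contraction bound. [cite: EscuderoGutierrez2023, Cor 1.7, Question 4.5]
[cite: AaronsonAmbainis2014, Conj. 6] -/
theorem pseudoBoundedAA_of_contractionBound_of_levelDescent
    (hK : ∃ (a : ℕ) (A : ℝ), 0 < A ∧ ∀ (N T m : ℕ) (q : Fin m → MvPolynomial (Fin N) ℝ)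
      (p : MvPolynomial (Fin N) ℝ), 1 ≤ T → (∀ j, (q j).totalDegree ≤ T) →
      (∀ x, evalBool p x = ∑ j, evalBool (q j) x ^ 2) → (∀ x, evalBool p x ≤ 1) →
      ∀ (c : Finset (Fin N) → ℝ) (M : ℝ),
        (∀ k : Fin N, ∑ U ∈ Finset.univ.filter (fun U : Finset (Fin N) => U.card = 2 * T ∧ k ∈ U), c U ^ 2 ≤ M) →
        ∑ j, ∑ R ∈ Finset.univ.filter (fun R : Finset (Fin N) => R.card = T),
          (∑ U ∈ Finset.univ.filter (fun U : Finset (Fin N) => U.card = 2 * T ∧ R ⊆ U),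
            c U * cubeFourierCoeff (evalBool (q j)) (U \ R)) ^ 2 ≤ A * (T : ℝ) ^ a * M)
    (hD : ∃ (a : ℕ) (A B : ℝ), 0 < A ∧ 0 < B ∧
      ∀ (N T : ℕ) (p : MvPolynomial (Fin N) ℝ) (ε : ℝ), 1 ≤ T → PseudoBounded T p → 0 < ε →
        ε ≤ boolVariance p →
        ∃ (N' T' : ℕ) (q : MvPolynomial (Fin N') ℝ), 1 ≤ T' ∧ T' ≤ T ∧ PseudoBounded T' q ∧
          (T' = 1 ∨ (∀ x : Fin N' → Bool, ∑ i : Fin N', (evalBool q x - evalBool q (Function.update x i (!x i))) =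
            4 * (T' : ℝ) * (evalBool q x - boolAvg (evalBool q)))) ∧
          A * (ε / T) ^ a ≤ boolVariance q ∧
          ∀ i : Fin N', ∃ i' : Fin N, influence i q ≤ B * influence i' p) :
    Summit.QuantumAdvantage.QuantumAdvantage.Theses.SosSandwich.PseudoBoundedAA :=
  pseudoBoundedAA_of_homogeneousPBAAT_of_levelDescent (homogeneousPBAAT_of_contractionBound hK) hD

end TopPairing

end Summit.QuantumAdvantage.QuantumAdvantage.Theorems.SosSandwich

end
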